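import Summits.NavierStokesRegularity.NavierStokesRegularity.Theses.AxisymmetricExtremality
import Summits.NavierStokesRegularity.NavierStokesRegularity.Theorems.AxisymmetricExtremalityPFoldToAxisymmetric
import Summits.NavierStokesRegularity.NavierStokesRegularity.Theorems.AxisymmetricExtremalityMinimalDatumPFoldRelativeToAXH

/-!
# Strategy census s4 (independent, family `-s`) — crux `AxisymmetricKatoGlobal` (stmt-NavierStokesRegularity-15453)

Kernel-checked bookkeeping for `Cruxes/AxisymmetricKatoGlobal/STRATEGY-CENSUS-s4.md` (§ Weaken).
Nothing here is new mathematics: every theorem is a few lines of logic over the route file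
`Theses/AxisymmetricExtremality.lean` (`closes`, rev 2), the PROVED sibling crux
`axisymmetricExtremality_pFoldToAxisymmetric_proof` and the landed vacuity lemma
`MinimalDatumPFold.Negative.cruxBody_of_navierStokesRegularity` (p158786).

* `NoAxisymMinimalDatum` (T0) — the WEAKEST statement that can replace the crux in `closes`:
  no Rusin–Šverák minimal blow-up datum is axisymmetric. `closes` consumes the crux only there
  (`navierStokesRegularity_of_noAxisymMinimalDatum`), the crux implies it
  (`noAxisymMinimalDatum_of_axisymmetricKatoGlobal`), and T0 already plays the crux's full logical
  role in the route (`minimalDatumPFold_iff_summit_of_noAxisymMinimalDatum`).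
* T0 is literally "AX_H on the threshold sphere `‖g‖ = ρ_max^pure(ν)`"
  (`noAxisymMinimalDatum_iff_thresholdRegular`) and is vacuous under Kato-class global regularity
  (`noAxisymMinimalDatum_of_rhoMax_top`, `rhoMax_top_of_katoGlobalAll`), of which the crux is the
  axisymmetric special case (`axisymmetricKatoGlobal_of_katoGlobalAll`).

References: W. Rusin, V. Šverák, J. Funct. Anal. 260 (2011) = arXiv:0911.0500 [RusinSverak2011].
-/

set_option linter.dupNamespace false

namespace Summit.NavierStokesRegularity.NavierStokesRegularity.Cruxes.AxisymmetricKatoGlobal.StrategyCensusS4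

open Summit.NavierStokesRegularity.NavierStokesRegularity.Theses.AxisymmetricExtremality
open Summit.NavierStokesRegularity.NavierStokesRegularity.Theorems
open MeasureTheory
open scoped ENNReal

/-- The crux's axisymmetry clause (verbatim; `= Literature.Analysis.FluidPDE.IsAxisymmetric u₀` by `Iff.rfl`). -/
def AxisymClause (u₀ : EuclideanSpace ℝ (Fin 3) → EuclideanSpace ℝ (Fin 3)) : Prop :=
  ∀ (θ : ℝ) (x : EuclideanSpace ℝ (Fin 3)), u₀ (WithLp.toLp 2 ![Real.cos θ * x 0 - Real.sin θ * x 1, Real.sin θ * x 0 + Real.cos θ * x 1, x 2]) = WithLp.toLp 2 ![Real.cos θ * u₀ x 0 - Real.sin θ * u₀ x 1, Real.sin θ * u₀ x 0 + Real.cos θ * u₀ x 1, u₀ x 2]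

/-- Admissibility of a critical datum as in the crux: `u₀ ∈ L³`, represented by `g ∈ Ḣ^{1/2}`, weakly divergence-free. -/
def Admissible (u₀ : EuclideanSpace ℝ (Fin 3) → EuclideanSpace ℝ (Fin 3))
    (g : Literature.Analysis.FunctionSpaces.HomSobolev (EuclideanSpace ℝ (Fin 3)) (EuclideanSpace ℂ (Fin 3)) (1 / 2 : ℝ)) : Prop :=
  MemLp u₀ 3 volume ∧ g.Represents (Literature.Analysis.FunctionSpaces.EuclideanSpace.complexify ∘ u₀) ∧
    Literature.Analysis.FluidPDE.IsWeaklyDivFree u₀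

/-- **T0.** No Rusin–Šverák minimal blow-up datum (`‖g‖_{Ḣ^{1/2}} = ρ_max^pure(ν)`, no global Kato solution) is
axisymmetric about the `x 2`-axis. -/
def NoAxisymMinimalDatum : Prop :=
  ∀ ν : ℝ, 0 < ν → ∀ (u₀ : EuclideanSpace ℝ (Fin 3) → EuclideanSpace ℝ (Fin 3))
    (g : Literature.Analysis.FunctionSpaces.HomSobolev (EuclideanSpace ℝ (Fin 3)) (EuclideanSpace ℂ (Fin 3)) (1 / 2 : ℝ)),
    Literature.Analysis.FluidPDE.IsMinimalBlowupDatum ν u₀ g → AxisymClause u₀ → False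

/-- AX_H restricted to the threshold sphere: every admissible axisymmetric datum WITH `‖g‖ = ρ_max^pure(ν)` is global. -/
def AxisymThresholdRegular : Prop :=
  ∀ ν : ℝ, 0 < ν → ∀ (u₀ : EuclideanSpace ℝ (Fin 3) → EuclideanSpace ℝ (Fin 3))
    (g : Literature.Analysis.FunctionSpaces.HomSobolev (EuclideanSpace ℝ (Fin 3)) (EuclideanSpace ℂ (Fin 3)) (1 / 2 : ℝ)),
    Admissible u₀ g → AxisymClause u₀ → ‖g‖ₑ = Literature.Analysis.FluidPDE.rusinSverakRhoMaxPure ν →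
    Literature.Analysis.FluidPDE.HasGlobalKatoSolution ν u₀

/-- Kato-class global regularity for ALL admissible critical data (the summit in the Kato class; no symmetry). -/
def KatoGlobalAll : Prop :=
  ∀ ν : ℝ, 0 < ν → ∀ (u₀ : EuclideanSpace ℝ (Fin 3) → EuclideanSpace ℝ (Fin 3))
    (g : Literature.Analysis.FunctionSpaces.HomSobolev (EuclideanSpace ℝ (Fin 3)) (EuclideanSpace ℂ (Fin 3)) (1 / 2 : ℝ)),
    MemLp u₀ 3 volume → g.Represents (Literature.Analysis.FunctionSpaces.EuclideanSpace.complexify ∘ u₀) →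
    Literature.Analysis.FluidPDE.IsWeaklyDivFree u₀ → Literature.Analysis.FluidPDE.HasGlobalKatoSolution ν u₀

/-! ## §1 T0 is what `closes` consumes, and all it consumes -/

/-- The crux implies T0 (specialisation to the threshold sphere). -/
theorem noAxisymMinimalDatum_of_axisymmetricKatoGlobal (h : AxisymmetricKatoGlobal) : NoAxisymMinimalDatum := by
  intro ν hν u₀ g hmin hax
  obtain ⟨hL3, hrep, hdiv, -, hnot⟩ := hmin
  exact hnot (h ν hν u₀ g hL3 hrep hdiv hax)

/-- `closes` with T0 in place of the crux: the route's deciding theorem needs AX_H only at an axisymmetric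
minimal blow-up datum (produced by `MinimalDatumPFold` and the proved `PFoldToAxisymmetric`). -/
theorem navierStokesRegularity_of_noAxisymMinimalDatum (h₂ : MinimalDatumPFold) (h0 : NoAxisymMinimalDatum) :
    _root_.NavierStokesRegularity := by
  show Literature.NS.NavierStokesExistenceSmoothR3
  intro ν hν u₀ hsm hdiv hdec
  by_contra hno
  obtain ⟨u₁, g, hmin, hax⟩ :=
    axisymmetricExtremality_pFoldToAxisymmetric_proof ν hν (h₂ ν hν ⟨u₀, hsm, hdiv, hdec, hno⟩)
  exact h0 ν hν u₁ g hmin hax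

/-- T0 already plays the crux's full logical role in the route: relative to T0 the companion crux
`MinimalDatumPFold` is the summit (compare `stub_minimalDatumPFoldIffSummitOfAXH`). -/
theorem minimalDatumPFold_iff_summit_of_noAxisymMinimalDatum (h0 : NoAxisymMinimalDatum) :
    MinimalDatumPFold ↔ _root_.NavierStokesRegularity :=
  ⟨fun h₂ => navierStokesRegularity_of_noAxisymMinimalDatum h₂ h0,
   fun hS => MinimalDatumPFold.Negative.cruxBody_of_navierStokesRegularity hS⟩

/-! ## §2 What T0 says: AX_H on the threshold sphere; vacuous under Kato-class regularity -/

/-- T0 is AX_H restricted to the sphere `‖g‖ = ρ_max^pure(ν)` (pure unfolding of `IsMinimalBlowupDatum`). -/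
theorem noAxisymMinimalDatum_iff_thresholdRegular : NoAxisymMinimalDatum ↔ AxisymThresholdRegular := by
  constructor
  · intro h0 ν hν u₀ g hadm hax hnorm
    by_contra hnot
    exact h0 ν hν u₀ g ⟨hadm.1, hadm.2.1, hadm.2.2, hnorm, hnot⟩ hax
  · intro h ν hν u₀ g hmin hax
    obtain ⟨hL3, hrep, hdiv, hnorm, hnot⟩ := hmin
    exact hnot (h ν hν u₀ g ⟨hL3, hrep, hdiv⟩ hax hnorm)

/-- If the pure threshold is infinite at every viscosity, T0 holds vacuously (`‖g‖ₑ < ⊤` in a normed group). -/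
theorem noAxisymMinimalDatum_of_rhoMax_top
    (h : ∀ ν : ℝ, 0 < ν → Literature.Analysis.FluidPDE.rusinSverakRhoMaxPure ν = ⊤) : NoAxisymMinimalDatum := by
  intro ν hν u₀ g hmin _
  obtain ⟨-, -, -, hnorm, -⟩ := hmin
  exact (enorm_ne_top (x := g)) (hnorm.trans (h ν hν))

/-- Kato-class global regularity makes the pure threshold infinite (`⊤` belongs to the defining set of the `sSup`). -/
theorem rhoMax_top_of_katoGlobalAll (h : KatoGlobalAll) :
    ∀ ν : ℝ, 0 < ν → Literature.Analysis.FluidPDE.rusinSverakRhoMaxPure ν = ⊤ := by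
  intro ν hν
  unfold Literature.Analysis.FluidPDE.rusinSverakRhoMaxPure
  refine top_le_iff.mp (le_sSup ?_)
  intro u₀ g h1 h2 h3 _
  exact h ν hν u₀ g h1 h2 h3

/-- The crux is the axisymmetric special case of Kato-class global regularity. -/
theorem axisymmetricKatoGlobal_of_katoGlobalAll (h : KatoGlobalAll) : AxisymmetricKatoGlobal :=
  fun ν hν u₀ g h1 h2 h3 _ => h ν hν u₀ g h1 h2 h3

/-- … and so is T0 (through either route: the crux, or the infinite threshold). -/
theorem noAxisymMinimalDatum_of_katoGlobalAll (h : KatoGlobalAll) : NoAxisymMinimalDatum :=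
  noAxisymMinimalDatum_of_rhoMax_top (rhoMax_top_of_katoGlobalAll h)

/-! ## §3 The logical position, summarised

Over the current tree: `KatoGlobalAll → AxisymmetricKatoGlobal → NoAxisymMinimalDatum`,
`NoAxisymMinimalDatum → (MinimalDatumPFold ↔ NavierStokesRegularity)`, and
`MinimalDatumPFold → (NoAxisymMinimalDatum → NavierStokesRegularity)`. No theorem of the tree gives
`NavierStokesRegularity → AxisymmetricKatoGlobal` or `→ NoAxisymMinimalDatum` (Clay (A) is stated for
Schwartz-class data; the Kato class contains infinite-energy data), nor any converse. -/

theorem census_summary :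
    (KatoGlobalAll → AxisymmetricKatoGlobal) ∧ (AxisymmetricKatoGlobal → NoAxisymMinimalDatum) ∧
    (NoAxisymMinimalDatum → (MinimalDatumPFold ↔ _root_.NavierStokesRegularity)) ∧
    (MinimalDatumPFold → NoAxisymMinimalDatum → _root_.NavierStokesRegularity) :=
  ⟨axisymmetricKatoGlobal_of_katoGlobalAll, noAxisymMinimalDatum_of_axisymmetricKatoGlobal,
   minimalDatumPFold_iff_summit_of_noAxisymMinimalDatum, navierStokesRegularity_of_noAxisymMinimalDatum⟩

end Summit.NavierStokesRegularity.NavierStokesRegularity.Cruxes.AxisymmetricKatoGlobal.StrategyCensusS4
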